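import Summits.KontsevichZagierPeriods.Zeta5Search.LaiSweepShard

/-!
# `κ₃` sweep certificate — shard file 107 of 127 (shards 749–755 of 889)

HONEST FRAMING. Systematic search; no irrationality claim unless certified. This file only checks,
by `decide +kernel`, shards 749–755 of the order-cell sweep of the `κ₃` point `(74, 2180, 444; δ74)`
(engine `LaiSweepEngine`, soundness `LaiSweepJump/Free/Eval/Shard/Kappa3`; a shard is `⟨regime, n,
p, q, p', q', Lo, Up⟩`: `n` cells from `p/q` to `p'/q'` with integer rate sums in `[Lo, Up]`, `K =
128`, `D = 2^40`). It draws NO conclusion: only the capstone `LaiKappa3SweepCert`, which needs all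
127 shard files, does. Kernel cost of this file ≈ 560 cells × 0.3 s.
-/

namespace Summit.KontsevichZagierPeriods.Zeta5Search.Sweep

set_option maxHeartbeats 100000000 in
/-- Shard 749: 80 cells of regime B from `352/427` to `71/86`.
[cite: Lai2024BallRivoal, §4 Lemma 4.3] -/
theorem shard749 :
    Shard.check 128 (2^40)
      ⟨true, 80, 352, 427, 71, 86, 10675508223645, 16945616613681⟩ = true := by
  decide +kernel

set_option maxHeartbeats 100000000 in
/-- Shard 750: 80 cells of regime B from `71/86` to `191/231`.
[cite: Lai2024BallRivoal, §4 Lemma 4.3] -/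
theorem shard750 :
    Shard.check 128 (2^40)
      ⟨true, 80, 71, 86, 191, 231, 10959202639086, 17414042451054⟩ = true := by
  decide +kernel

set_option maxHeartbeats 100000000 in
/-- Shard 751: 80 cells of regime B from `191/231` to `53/64`.
[cite: Lai2024BallRivoal, §4 Lemma 4.3] -/
theorem shard751 :
    Shard.check 128 (2^40)
      ⟨true, 80, 191, 231, 53, 64, 11176829798770, 17778659348043⟩ = true := by
  decide +kernel

set_option maxHeartbeats 100000000 in
/-- Shard 752: 80 cells of regime B from `53/64` to `209/252`.
[cite: Lai2024BallRivoal, §4 Lemma 4.3] -/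
theorem shard752 :
    Shard.check 128 (2^40)
      ⟨true, 80, 53, 64, 209, 252, 10780245212861, 17165896116371⟩ = true := by
  decide +kernel

set_option maxHeartbeats 100000000 in
/-- Shard 753: 80 cells of regime B from `209/252` to `152/183`.
[cite: Lai2024BallRivoal, §4 Lemma 4.3] -/
theorem shard753 :
    Shard.check 128 (2^40)
      ⟨true, 80, 209, 252, 152, 183, 10734076022366, 17110018871187⟩ = true := by
  decide +kernel

set_option maxHeartbeats 100000000 in
/-- Shard 754: 80 cells of regime B from `152/183` to `277/333`.
[cite: Lai2024BallRivoal, §4 Lemma 4.3] -/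
theorem shard754 :
    Shard.check 128 (2^40)
      ⟨true, 80, 152, 183, 277, 333, 10677709150069, 17037660353120⟩ = true := by
  decide +kernel

set_option maxHeartbeats 100000000 in
/-- Shard 755: 80 cells of regime B from `277/333` to `319/383`.
[cite: Lai2024BallRivoal, §4 Lemma 4.3] -/
theorem shard755 :
    Shard.check 128 (2^40)
      ⟨true, 80, 277, 333, 319, 383, 9243242597566, 14762888656464⟩ = true := by
  decide +kernel

/-- The checked shards of this file, in order. [folklore] -/
def shards107 : List (CheckedShard 128 (2^40)) :=
  [⟨_, shard749⟩, ⟨_, shard750⟩, ⟨_, shard751⟩, ⟨_, shard752⟩, ⟨_, shard753⟩,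
    ⟨_, shard754⟩, ⟨_, shard755⟩]

end Summit.KontsevichZagierPeriods.Zeta5Search.Sweep
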